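import Summits.QuantumAdvantage.AdviceFreeQNC0.LiftOneUBookkeeping
import Summits.QuantumAdvantage.AdviceFreeQNC0.CovLogSuffices
import Summits.QuantumAdvantage.AdviceFreeQNC0.LowDegreeParity
import HarnessLib

/-!
# Cell qa-qnc0 (rung F-S1, route RingFrame, crux α, line `tensor`): R1U at co-degree one —
# `LiftOneUCodegOne : LiftOneUAt 2 1` (qn-p2 ROUND-5 THEOREM E1), via the syndrome of `RM(m−2, m)`

Planner qa-qnc0-p2's ROUND-5 reduces the rung R1U (`LiftOneU`, kernel vocabulary
`LiftOneUBookkeeping.lean`) to its fixed-gap instances `LiftOneUAt c K` (`L' = d + c`, co-degree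
`e = c − 1`, `f = 2^c`).  This file proves the first instance,

* **THEOREM E1** `liftOneUCodegOne : LiftOneUCodegOne` (`:= LiftOneUAt 2 1`, Sketch5 verbatim):
  at `L' = d + 2` every matrix `X` with LINEAR columns is `(d+2)·w·2^L`-close (indeed
  `(d+3)·2^{L−1}`-close) to a matrix with linear columns and rows in `RM(d, d+2)`,

through the SYNDROME of the extended Hamming code `RM(m−2, m)`, `m = d + 2`, set up once for the later
co-degrees (E2/E3 use the same parity / point-sum invariants):

* `Syndrome.syn` — the linear map `g ↦ (Σ_v g(v), (Σ_v g(v)·v_i)_i)` on `𝔽₂^{{0,1}^m}`, indexed by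
  `Option (Fin m)` (`none` = parity, `some i` = `i`-th point sum);
* `Syndrome.lowDeg_le_ker` — `RM(d, d+2) ≤ ker syn` (a degree-`≤ d` function times a degree-`≤ 1`
  coefficient has degree `≤ d+1 < m`, hence even weight: `sum_univ_eq_zero_of_mem_lowDeg`);
* `Syndrome.zRep s` — the representative with syndrome `s` supported on `Z = {0, e₁, …, e_m}`
  (`syn_zRep`: `syn (zRep s) = s`; `zRep_apply_eq_zero`: `zRep s` vanishes off `Z`; `zRep_add`);
* `Syndrome.ker_eq_lowDeg` — **`ker syn = RM(d, d+2)`**: `syn` is onto (`zRep`), so by rank–nullity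
  `dim ker = 2^m − (m+1) = Σ_{j ≤ m−2} C(m,j) = dim RM(m−2,m)` (`Smolensky.finrank_lowDeg`).

Proof of E1 (ROUND-5 §2.1): `W(u,·) := X(u,·) + zRep (syn X(u,·))` has rows in `ker syn = RM(d,m)`,
linear columns (`u ↦ syn X(u,·)` is additive because the columns of `X` are — `apply_bx_of_linCols` —
and `zRep` is additive; `hasDeg_one_of_additive`), and differs from `X` only in the `d + 3` columns of
`Z`, so `hw (X ⊕ W) = 2^{L−1}·#colDiff ≤ 2^{L−1}(d+3) ≤ (d+2)·w·2^L` for `w ≥ 1` (`liftCostEq`); for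
`w = 0` or `L = 0` take `W = X`.  (The radius hypothesis `2w ≤ 4` is not used: at co-degree one EVERY
system has transversal number `≤ d + 3`.)

WHAT THIS IS NOT: nothing on co-degree `≥ 2` (E2/E3), on `LiftOneU` itself, `TRPlus`, α or the
separation. [folklore: RM(m−2,m) is the extended Hamming code, determined by parity and point sum]
-/

noncomputable section

namespace Summit.QuantumAdvantage.AdviceFreeQNC0

open Finset Module
open Literature.Computability.MetaComplexity Literature.Computability.MetaComplexity.Smolensky
open MeanLoad

/-- **THEOREM E1** (qn-p2 ROUND-5 §2.1, `Sketch5.LiftOneUCodegOne` verbatim; co-degree 1, `f = 4`):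
every coset of `RM(m−2,m)` has a representative on the transversal `{0} ∪ {basis vectors}`;
`cov ≤ d + 3`; constant `K = 1`. -/
def LiftOneUCodegOne : Prop := LiftOneUAt 2 1

namespace Syndrome

variable {m : ℕ}

/-! ### The syndrome map of the extended Hamming code -/

/-- coefficient function of the syndrome coordinate `o`: the constant `1` (parity) for `none`, the
coordinate `[v i]` (the `i`-th point sum) for `some i`. -/
def coef (o : Option (Fin m)) (v : Fin m → Bool) : ZMod 2 :=
  match o with
  | none => 1
  | some i => if v i = true then 1 else 0

/-- **The syndrome map** `g ↦ (Σ_v g v · coef o v)_o` (parity and point sums). -/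
def syn : CubeFn (ZMod 2) m →ₗ[ZMod 2] (Option (Fin m) → ZMod 2) where
  toFun g := fun o => ∑ v, g v * coef o v
  map_add' g h := by
    funext o
    simp only [Pi.add_apply, add_mul, Finset.sum_add_distrib]
  map_smul' c g := by
    funext o
    simp only [Pi.smul_apply, smul_eq_mul, RingHom.id_apply, mul_assoc, Finset.mul_sum]

/-- unfolding `syn`. -/
theorem syn_apply (g : CubeFn (ZMod 2) m) (o : Option (Fin m)) : syn g o = ∑ v, g v * coef o v := rfl

/-- the coefficient functions have degree `≤ 1`. -/
theorem coef_mem_lowDeg_one (o : Option (Fin m)) : (fun v => coef o v) ∈ lowDeg (ZMod 2) m 1 := by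
  cases o with
  | none =>
      have h : (fun v : Fin m → Bool => coef none v) = mono (ZMod 2) (∅ : Finset (Fin m)) := by
        funext v; simp [coef, mono_apply]
      rw [h]
      exact mono_mem_lowDeg (by simp)
  | some i =>
      have h : (fun v : Fin m → Bool => coef (some i) v) = mono (ZMod 2) ({i} : Finset (Fin m)) := by
        funext v; simp [coef, mono_apply]
      rw [h]
      exact mono_mem_lowDeg (by simp)

/-- **`RM(d, d+2) ≤ ker syn`**: degree-`≤ d` functions on `{0,1}^{d+2}` have zero parity and zero
point sums (`g · coef o` has degree `≤ d + 1 < d + 2`, hence sums to `0`). -/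
theorem lowDeg_le_ker (d : ℕ) :
    lowDeg (ZMod 2) (d + 2) d ≤ LinearMap.ker (syn (m := d + 2)) := by
  intro g hg
  rw [LinearMap.mem_ker]
  funext o
  rw [syn_apply, Pi.zero_apply]
  have hprod : g * (fun v => coef o v) ∈ lowDeg (ZMod 2) (d + 2) (d + 1) :=
    mul_mem_lowDeg_add hg (coef_mem_lowDeg_one o)
  have h := sum_univ_eq_zero_of_mem_lowDeg hprod (by omega)
  simpa [Pi.mul_apply] using h

/-! ### The transversal `Z = {0, e₁, …, e_m}` -/

/-- the point mass at `a`. -/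
def delta (a : Fin m → Bool) : CubeFn (ZMod 2) m := fun v => if v = a then 1 else 0

/-- the syndrome of a point mass: `syn δ_a = (coef o a)_o = (1, a)`. -/
theorem syn_delta (a : Fin m → Bool) (o : Option (Fin m)) : syn (delta a) o = coef o a := by
  rw [syn_apply]
  simp only [delta, ite_mul, one_mul, zero_mul, Finset.sum_ite_eq', Finset.mem_univ, if_true]

/-- **The `Z`-supported representative with syndrome `s`**:
`zRep s = (s₀ + Σ_i s_i)·δ_0 + Σ_i s_i·δ_{e_i}`. -/
def zRep (s : Option (Fin m) → ZMod 2) : CubeFn (ZMod 2) m :=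
  (s none + ∑ i, s (some i)) • delta (fun _ => false) + ∑ i, s (some i) • delta (basisRow i)

/-- `x + x = 0` in `𝔽₂`. [folklore] -/
private theorem add_self_zmod2 (x : ZMod 2) : x + x = 0 := by
  revert x; decide

/-- `zRep` is a section of the syndrome map: `syn (zRep s) = s`. -/
theorem syn_zRep (s : Option (Fin m) → ZMod 2) : syn (zRep s) = s := by
  funext o
  simp only [zRep, map_add, map_smul, map_sum, Pi.add_apply, Pi.smul_apply, Finset.sum_apply,
    smul_eq_mul, syn_delta]
  cases o with
  | none =>
      simp only [coef, mul_one]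
      rw [add_assoc, add_self_zmod2, add_zero]
  | some j =>
      have h0 : coef (some j) (fun _ : Fin m => false) = 0 := by simp [coef]
      have hb : ∀ i : Fin m, coef (some j) (basisRow i) = if j = i then 1 else 0 := by
        intro i; simp [coef, basisRow]
      rw [h0, mul_zero, zero_add]
      simp_rw [hb]
      simp [mul_ite, Finset.sum_ite_eq]

/-- `zRep s` is supported on `Z = {0} ∪ {e_i}`. -/
theorem zRep_apply_eq_zero (s : Option (Fin m) → ZMod 2) {v : Fin m → Bool}
    (hv0 : v ≠ fun _ => false) (hvi : ∀ i, v ≠ basisRow i) : zRep s v = 0 := by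
  simp only [zRep, Pi.add_apply, Pi.smul_apply, Finset.sum_apply, smul_eq_mul, delta, if_neg hv0,
    mul_zero, zero_add]
  refine Finset.sum_eq_zero fun i _ => ?_
  rw [if_neg (hvi i), mul_zero]

/-- `zRep` is additive. -/
theorem zRep_add (s s' : Option (Fin m) → ZMod 2) : zRep (s + s') = zRep s + zRep s' := by
  funext v
  simp only [zRep, Pi.add_apply, Pi.smul_apply, Finset.sum_apply, smul_eq_mul, add_mul,
    Finset.sum_add_distrib]
  ring

/-- `zRep 0 = 0`. -/
theorem zRep_zero : zRep (0 : Option (Fin m) → ZMod 2) = 0 := by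
  funext v
  simp [zRep]

/-! ### `ker syn = RM(d, d+2)` by counting dimensions -/

/-- `dim ker syn + (m + 1) = 2^m` (the syndrome map is onto). -/
theorem finrank_ker_add (m : ℕ) :
    finrank (ZMod 2) (LinearMap.ker (syn (m := m))) + (m + 1) = 2 ^ m := by
  have hsurj : LinearMap.range (syn (m := m)) = ⊤ :=
    LinearMap.range_eq_top.2 fun s => ⟨zRep s, syn_zRep s⟩
  have h := LinearMap.finrank_range_add_finrank_ker (syn (m := m))
  rw [hsurj, finrank_top, finrank_fintype_fun_eq_card, Fintype.card_option, Fintype.card_fin,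
    finrank_fintype_fun_eq_card, Fintype.card_fun, Fintype.card_bool, Fintype.card_fin] at h
  omega

/-- `dim RM(d, d+2) + (d + 3) = 2^{d+2}`. -/
theorem finrank_lowDeg_codegOne (d : ℕ) :
    finrank (ZMod 2) (lowDeg (ZMod 2) (d + 2) d) + (d + 3) = 2 ^ (d + 2) := by
  rw [finrank_lowDeg]
  have h := Nat.sum_range_choose (d + 2)
  rw [Finset.sum_range_succ, Finset.sum_range_succ, Nat.choose_self, Nat.choose_succ_self_right] at h
  omega

/-- **`ker syn = RM(d, d+2)`**: the extended Hamming code is cut out by parity and point sums. -/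
theorem ker_eq_lowDeg (d : ℕ) : LinearMap.ker (syn (m := d + 2)) = lowDeg (ZMod 2) (d + 2) d := by
  symm
  refine Submodule.eq_of_le_of_finrank_le (lowDeg_le_ker d) ?_
  have h1 := finrank_ker_add (d + 2)
  have h2 := finrank_lowDeg_codegOne d
  omega

end Syndrome

/-! ### The lift at co-degree one -/

section

open Syndrome

variable {L d : ℕ}

/-- `[decide (z = 1)] = z` in `𝔽₂`. [folklore] -/
private theorem ind_decide (z : ZMod 2) : (if decide (z = 1) = true then (1 : ZMod 2) else 0) = z := by
  revert z; decide

/-- `decide ((x + y) = 1) = decide (x = 1) ⊕ decide (y = 1)` in `𝔽₂`. [folklore] -/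
private theorem decide_add (x y : ZMod 2) : decide (x + y = 1) = xor (decide (x = 1)) (decide (y = 1)) := by
  revert x y; decide

/-- the `𝔽₂`-row of `X` at `u`. -/
def rowZ (X : BMat L (d + 2)) (u : Fin L → Bool) : CubeFn (ZMod 2) (d + 2) :=
  fun v => if X u v = true then 1 else 0

/-- the correction of row `u`: the `Z`-supported word with the same syndrome as `X(u,·)`. -/
def corr (X : BMat L (d + 2)) (u : Fin L → Bool) : CubeFn (ZMod 2) (d + 2) := zRep (syn (rowZ X u))

/-- **The lift**: `W(u,·) = X(u,·) + corr u`. -/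
def liftW (X : BMat L (d + 2)) : BMat L (d + 2) := fun u v => xor (X u v) (decide (corr X u v = 1))

/-- the `𝔽₂`-row of the lift is `rowZ X u + corr X u`. -/
theorem ind_liftW (X : BMat L (d + 2)) (u : Fin L → Bool) (v : Fin (d + 2) → Bool) :
    (if liftW X u v = true then (1 : ZMod 2) else 0) = rowZ X u v + corr X u v := by
  unfold liftW
  rw [ind_xor, ind_decide]
  rfl

/-- Rows of a matrix with linear columns are additive in `𝔽₂^{{0,1}^{L'}}`. -/
theorem rowZ_bx {X : BMat L (d + 2)} (hX : LinCols X) (u u' : Fin L → Bool) :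
    rowZ X (bx u u') = rowZ X u + rowZ X u' := by
  funext v
  show (if X (bx u u') v = true then (1 : ZMod 2) else 0) = _
  rw [apply_bx_of_linCols hX u u' v, ind_xor]
  rfl

/-- the `𝔽₂`-row at `u = 0` vanishes (linear columns). -/
theorem rowZ_zero {X : BMat L (d + 2)} (hX : LinCols X) : rowZ X (fun _ => false) = 0 := by
  funext v
  show (if X (fun _ => false) v = true then (1 : ZMod 2) else 0) = 0
  rw [hX.2 v]
  rfl

/-- The correction is additive in `u` and vanishes at `u = 0`. -/
theorem corr_bx {X : BMat L (d + 2)} (hX : LinCols X) (u u' : Fin L → Bool) :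
    corr X (bx u u') = corr X u + corr X u' := by
  unfold corr
  rw [rowZ_bx hX, map_add, zRep_add]

/-- the correction at `u = 0` vanishes. -/
theorem corr_zero {X : BMat L (d + 2)} (hX : LinCols X) : corr X (fun _ => false) = 0 := by
  unfold corr
  rw [rowZ_zero hX, map_zero, zRep_zero]

/-- **The lift has rows in `RM(d, d+2)`** (their syndrome is `syn X(u,·) + syn X(u,·) = 0`). -/
theorem rowsDeg_liftW (X : BMat L (d + 2)) : RowsDeg d (liftW X) := by
  intro u
  show (fun v => if liftW X u v = true then (1 : ZMod 2) else 0) ∈ lowDeg (ZMod 2) (d + 2) d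
  have h : (fun v => if liftW X u v = true then (1 : ZMod 2) else 0) = rowZ X u + corr X u :=
    funext fun v => ind_liftW X u v
  rw [h, ← ker_eq_lowDeg d, LinearMap.mem_ker, map_add]
  unfold corr
  rw [syn_zRep]
  funext o
  exact Syndrome.add_self_zmod2 _

/-- **The lift has linear columns.** -/
theorem linCols_liftW {X : BMat L (d + 2)} (hX : LinCols X) : LinCols (liftW X) := by
  refine ⟨fun v => ?_, fun v => ?_⟩
  · have hadd : ∀ u u', decide (corr X (bx u u') v = 1) =
        xor (decide (corr X u v = 1)) (decide (corr X u' v = 1)) := by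
      intro u u'
      rw [corr_bx hX, Pi.add_apply, decide_add]
    exact hasDeg_xor (hX.1 v) (hasDeg_one_of_additive hadd)
  · show xor (X (fun _ => false) v) (decide (corr X (fun _ => false) v = 1)) = false
    rw [hX.2 v, corr_zero hX]
    rfl

/-- The lift differs from `X` only in the columns of `Z = {0} ∪ {e_i}`. -/
theorem colDiff_liftW_subset (X : BMat L (d + 2)) :
    colDiff X (liftW X) ⊆
      insert (fun _ => false) (univ.image (basisRow : Fin (d + 2) → (Fin (d + 2) → Bool))) := by
  intro v hv
  rw [colDiff, Finset.mem_filter] at hv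
  obtain ⟨u, hu⟩ := hv.2
  by_contra hZ
  rw [Finset.mem_insert, not_or, Finset.mem_image] at hZ
  have hvi : ∀ i, v ≠ basisRow i := fun i h => hZ.2 ⟨i, Finset.mem_univ _, h.symm⟩
  have h0 : corr X u v = 0 := zRep_apply_eq_zero _ hZ.1 hvi
  apply hu
  show X u v = xor (X u v) (decide (corr X u v = 1))
  rw [h0]
  cases X u v <;> rfl

/-- `#Z ≤ d + 3`. -/
theorem card_colDiff_liftW_le (X : BMat L (d + 2)) : (colDiff X (liftW X)).card ≤ d + 3 := by
  refine (Finset.card_le_card (colDiff_liftW_subset X)).trans ?_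
  refine (Finset.card_insert_le _ _).trans ?_
  have h := Finset.card_image_le (s := (univ : Finset (Fin (d + 2)))) (f := basisRow)
  rw [Finset.card_univ, Fintype.card_fin] at h
  omega

end

/-! ### THEOREM E1 -/

/-- A row at distance `0` from a degree-`d` row has degree `d`. -/
private theorem rowsDeg_of_rowDist_zero {L L' d : ℕ} {X Y : BMat L L'} (hY : RowsDeg d Y)
    (h : ∀ u, rowDist X Y u = 0) : RowsDeg d X := by
  intro u
  have e : X u = Y u := row_eq_of_rowDist_eq_zero (h u)
  have hYu := hY u
  rw [← e] at hYu
  exact hYu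

/-- **THEOREM E1: `liftOneUCodegOne : LiftOneUCodegOne`** (R1U at co-degree one, constant `1`). -/
theorem liftOneUCodegOne : LiftOneUCodegOne := by
  intro L d w _hw2 X Y hX hY hdist
  rcases Nat.eq_zero_or_pos w with rfl | hwpos
  · -- `w = 0`: the rows of `X` are those of `Y`; `W = X`
    refine ⟨X, hX, rowsDeg_of_rowDist_zero hY fun u => Nat.le_zero.1 (hdist u), ?_⟩
    rw [hw_xorM_self]
    simp
  rcases Nat.eq_zero_or_pos L with rfl | hLpos
  · -- `L = 0`: the only row index is `0`, where `X` vanishes; `W = X`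
    refine ⟨X, hX, fun u => ?_, ?_⟩
    · have hu : u = fun _ => false := funext fun i => Fin.elim0 i
      subst hu
      show (fun v => if X (fun _ => false) v = true then (1 : ZMod 2) else 0) ∈ lowDeg (ZMod 2) (d + 2) d
      have h : (fun v => if X (fun _ => false) v = true then (1 : ZMod 2) else 0) = 0 :=
        funext fun v => by rw [hX.2 v]; rfl
      rw [h]
      exact Submodule.zero_mem _
    · rw [hw_xorM_self, Nat.cast_zero]
      positivity
  -- main case: the syndrome lift
  refine ⟨liftW X, linCols_liftW hX, rowsDeg_liftW X, ?_⟩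
  have hcost : hw (xorM X (liftW X)) = 2 ^ (L - 1) * (colDiff X (liftW X)).card :=
    hw_xorM_eq_of_linCols hX (linCols_liftW hX)
  have hcard := card_colDiff_liftW_le X
  -- `2^{L-1}·(d+3) ≤ (d+2)·w·2^L` for `w ≥ 1`, `L ≥ 1`
  have hpow : 2 ^ L = 2 * 2 ^ (L - 1) := by
    rw [← Nat.pow_succ']; congr 1; omega
  have hnat : hw (xorM X (liftW X)) ≤ (d + 2) * w * 2 ^ L := by
    rw [hcost, hpow]
    calc 2 ^ (L - 1) * (colDiff X (liftW X)).card ≤ 2 ^ (L - 1) * (d + 3) :=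
          Nat.mul_le_mul_left _ hcard
      _ ≤ 2 ^ (L - 1) * (2 * (d + 2) * w) := Nat.mul_le_mul_left _ (by nlinarith)
      _ = (d + 2) * w * (2 * 2 ^ (L - 1)) := by ring
  have hR : ((hw (xorM X (liftW X)) : ℕ) : ℝ) ≤ (((d + 2) * w * 2 ^ L : ℕ) : ℝ) := by exact_mod_cast hnat
  refine hR.trans (le_of_eq ?_)
  push_cast
  ring

end Summit.QuantumAdvantage.AdviceFreeQNC0

end
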